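import Mathlib
import Summits.MatrixMultiplication.MatrixMultiplication.Theses.MatrixPointInterpolation
import Summits.MatrixMultiplication.MatrixMultiplication.Theorems.MatrixPointInterpolationWindowedKaplanskyCapelli

/-!
# Crux `TightWindows` (stmt-MatrixMultiplication-18939), line `shirshov-split` — stub
# `stub_noSlowMasquerade` (no slow masquerade: the frame argument)

Registered stub `stub_noSlowMasquerade` of the skeleton of line `shirshov-split`: for every point
size `k` there is a constant `C` (we take `C = (k+2)(k(k+1)/2 + k)`) such that a pair
`A : Fin 2 → M_n(ℂ)`, `n > k`, generating `M_n` in degree `d` (`V_d = M_n`, `V_j = wordSpan A j`)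
and satisfying every two-letter identity of `M_k(ℂ)` supported in degree `≤ 2d` has `d ≤ C·n`.
The proof is uniform in `k` and does not use Amitsur–Levitzki.

* **Frame filling** (`exists_mem_wordSpan_mulVec_single_eq`).  Let `Φ X = (X e_0, …, X e_k)` record
  the first `k + 1` columns.  The subspaces `Φ(V_e)` increase with `e`; if `Φ(V_e) = Φ(V_{e+1})` then
  `Φ⁻¹(Φ(V_e)) ∋ 1` is stable under left multiplication by `A 0, A 1`, hence contains every word,
  hence `Φ(V_e) = Φ(V_d) = Φ(M_n)` is everything (`map_wordSpan_eq_top_of_stable`).  So the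
  dimensions grow strictly until everything is reached, which happens by `e = (k+1)n + 1`
  (`map_wordSpan_finrank_succ_eq_top`): every prescription of `k + 1` columns is realised in
  `V_{(k+1)n+1}`.
* **Path evaluation** (`capMon_mulVec_last`, `capPow_mulVec_last`).  Pick `Y ∈ V_{(k+1)n+1}` with
  `Y e_j = j e_j` (`j ≤ k`) and `Z_i ∈ V_{(k+1)n+1}` with `Z_i e_{i+1} = e_i`.  Then the monomial
  `Y^{σ 0} Z_0 Y^{σ 1} Z_1 ⋯ Z_{k-1} Y^{σ k}` of the Cayley–Hamilton–Capelli polynomial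
  `P_k = capPow k` sends `e_k` to `(∏_j j^{σ j}) e_0`, so `P_k(Y; Z) e_k = det(Vandermonde(0,…,k)) e_0 ≠ 0`.
* **Window** (`Masquerade.capPow_eq_zero_of_window`).  `P_k` is an identity of `M_k`, so
  `P_k(Y; Z) = 0` as soon as `e·k(k+1)/2 + k·e ≤ 2d`, `e = (k+1)n + 1 ≤ (k+2)n`; this budget holds if
  `d > C·n`.  Contradiction.
-/

set_option linter.dupNamespace false
-- `MatrixMultiplication.MatrixMultiplication` is the summit/sub-problem path (D-0017)

namespace Summit.MatrixMultiplication.MatrixMultiplication.Theorems.TightWindows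

open scoped BigOperators
open scoped Matrix
open Summit.MatrixMultiplication.MatrixMultiplication.Theorems.Masquerade Equiv

/-! ### Frame filling: the images `Φ(V_e)` grow strictly until they are everything -/

/-- Stabilisation.  Let `Φ` be a linear surjection from `M_n(ℂ)` intertwining left multiplication
by each generator `A x` with some self-map `T x` of the target, and assume `V_d = M_n`.  If
`Φ(V_{e+1}) = Φ(V_e)` for one `e`, then `Φ(V_e)` is everything. [folklore] -/
theorem map_wordSpan_eq_top_of_stable {n d : ℕ} {A : Fin 2 → Matrix (Fin n) (Fin n) ℂ}
    (hspan : wordSpan A d = ⊤) {W : Type*} [AddCommGroup W] [Module ℂ W]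
    {Φ : Matrix (Fin n) (Fin n) ℂ →ₗ[ℂ] W} (hΦ : Function.Surjective Φ) {T : Fin 2 → W → W}
    (hT : ∀ x X, Φ (A x * X) = T x (Φ X)) {e : ℕ}
    (he : (wordSpan A (e + 1)).map Φ = (wordSpan A e).map Φ) :
    (wordSpan A e).map Φ = ⊤ := by
  have hle : wordSpan A d ≤ ((wordSpan A e).map Φ).comap Φ := by
    refine wordSpan_le_of_mul_mem A _ ?_ ?_ d
    · exact Submodule.mem_comap.2 (Submodule.mem_map_of_mem (one_mem_wordSpan A e))
    · intro x M hM
      obtain ⟨X, hX, hXM⟩ := Submodule.mem_map.1 (Submodule.mem_comap.1 hM)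
      have hAX : A x * X ∈ wordSpan A (e + 1) := by
        rw [add_comm]
        exact mul_mem_wordSpan (gen_mem_wordSpan A le_rfl x) hX
      have hΦM : Φ (A x * M) = Φ (A x * X) := by rw [hT, hT, hXM]
      rw [Submodule.mem_comap, hΦM, ← he]
      exact Submodule.mem_map_of_mem hAX
  refine eq_top_iff.2 fun w _ => ?_
  obtain ⟨M, rfl⟩ := hΦ w
  have hM : M ∈ wordSpan A d := by
    rw [hspan]
    exact Submodule.mem_top
  exact Submodule.mem_comap.1 (hle hM)

/-- Growth.  Under the same hypotheses (finite-dimensional target), for every `e` the image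
`Φ(V_e)` is everything or has dimension `≥ e`. [folklore] -/
theorem map_wordSpan_eq_top_or_le_finrank {n d : ℕ} {A : Fin 2 → Matrix (Fin n) (Fin n) ℂ}
    (hspan : wordSpan A d = ⊤) {W : Type*} [AddCommGroup W] [Module ℂ W] [FiniteDimensional ℂ W]
    {Φ : Matrix (Fin n) (Fin n) ℂ →ₗ[ℂ] W} (hΦ : Function.Surjective Φ) {T : Fin 2 → W → W}
    (hT : ∀ x X, Φ (A x * X) = T x (Φ X)) :
    ∀ e : ℕ, (wordSpan A e).map Φ = ⊤ ∨ e ≤ Module.finrank ℂ ((wordSpan A e).map Φ)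
  | 0 => Or.inr (Nat.zero_le _)
  | e + 1 => by
    have hmono : (wordSpan A e).map Φ ≤ (wordSpan A (e + 1)).map Φ :=
      Submodule.map_mono (wordSpan_mono A e.le_succ)
    rcases map_wordSpan_eq_top_or_le_finrank hspan hΦ hT e with h | h
    · exact Or.inl (top_unique (h.ge.trans hmono))
    · by_cases hst : (wordSpan A (e + 1)).map Φ = (wordSpan A e).map Φ
      · exact Or.inl (hst.trans (map_wordSpan_eq_top_of_stable hspan hΦ hT hst))
      · exact Or.inr (Nat.succ_le_of_lt (h.trans_lt
          (Submodule.finrank_lt_finrank_of_lt (lt_of_le_of_ne hmono (Ne.symm hst)))))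

/-- Frame filling, abstract form: `Φ(V_{dim W + 1})` is everything. [folklore] -/
theorem map_wordSpan_finrank_succ_eq_top {n d : ℕ} {A : Fin 2 → Matrix (Fin n) (Fin n) ℂ}
    (hspan : wordSpan A d = ⊤) {W : Type*} [AddCommGroup W] [Module ℂ W] [FiniteDimensional ℂ W]
    {Φ : Matrix (Fin n) (Fin n) ℂ →ₗ[ℂ] W} (hΦ : Function.Surjective Φ) {T : Fin 2 → W → W}
    (hT : ∀ x X, Φ (A x * X) = T x (Φ X)) :
    (wordSpan A (Module.finrank ℂ W + 1)).map Φ = ⊤ := by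
  rcases map_wordSpan_eq_top_or_le_finrank hspan hΦ hT (Module.finrank ℂ W + 1) with h | h
  · exact h
  · have := Submodule.finrank_le ((wordSpan A (Module.finrank ℂ W + 1)).map Φ)
    omega

/-- **Frame filling.**  If `V_d = M_n` and `k + 1 ≤ n`, then every prescription `g` of the
`k + 1` columns `0, …, k` is realised by some `X ∈ V_{(k+1)n+1}`. [folklore] -/
theorem exists_mem_wordSpan_mulVec_single_eq {n k d : ℕ} {A : Fin 2 → Matrix (Fin n) (Fin n) ℂ}
    (hkn : k + 1 ≤ n) (hspan : wordSpan A d = ⊤) (g : Fin (k + 1) → Fin n → ℂ) :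
    ∃ X ∈ wordSpan A ((k + 1) * n + 1), ∀ j, X *ᵥ Pi.single (Fin.castLE hkn j) 1 = g j := by
  obtain ⟨Φ, hΦ⟩ : ∃ Φ : Matrix (Fin n) (Fin n) ℂ →ₗ[ℂ] (Fin (k + 1) → Fin n → ℂ),
      ∀ X j, Φ X j = X *ᵥ Pi.single (Fin.castLE hkn j) 1 :=
    ⟨{ toFun := fun X j => X *ᵥ Pi.single (Fin.castLE hkn j) 1
       map_add' := fun X X' => by
         funext j
         exact Matrix.add_mulVec X X' _
       map_smul' := fun c X => by
         funext j
         exact Matrix.smul_mulVec c X _ }, fun _ _ => rfl⟩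
  have hsurj : Function.Surjective Φ := fun g =>
    ⟨Matrix.of fun i i' => if h : (i' : ℕ) < k + 1 then g ⟨i', h⟩ i else 0, funext fun j => by
      rw [hΦ, Matrix.mulVec_single_one]
      funext i
      simp only [Matrix.col_apply, Matrix.of_apply, Fin.val_castLE]
      rw [dif_pos j.is_lt]⟩
  have hfin : Module.finrank ℂ (Fin (k + 1) → Fin n → ℂ) = (k + 1) * n := by
    rw [Module.finrank_pi_fintype]
    simp
  have htop := map_wordSpan_finrank_succ_eq_top hspan hsurj (T := fun x g j => A x *ᵥ g j)
    fun x X => funext fun j => by simp only [hΦ, Matrix.mulVec_mulVec]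
  rw [hfin] at htop
  have hg : g ∈ (wordSpan A ((k + 1) * n + 1)).map Φ := by
    rw [htop]
    exact Submodule.mem_top
  obtain ⟨X, hX, hXg⟩ := Submodule.mem_map.1 hg
  exact ⟨X, hX, fun j => by rw [← hΦ, hXg]⟩

/-! ### Path evaluation of the Cayley–Hamilton–Capelli polynomial -/

/-- Powers of a matrix act on an eigenvector by powers of the eigenvalue. [folklore] -/
theorem pow_mulVec_of_mulVec_eq_smul {R : Type*} [CommRing R] {ι : Type*} [Fintype ι]
    [DecidableEq ι] {Y : Matrix ι ι R} {w : ι → R} {a : R} (h : Y *ᵥ w = a • w) :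
    ∀ p : ℕ, Y ^ p *ᵥ w = a ^ p • w
  | 0 => by simp
  | p + 1 => by
    rw [pow_succ, ← Matrix.mulVec_mulVec, h, Matrix.mulVec_smul, pow_mulVec_of_mulVec_eq_smul h p,
      smul_smul, pow_succ']

/-- A chain of matrices `f i` moving `u (i+1)` to `c i • u i` moves, as an (ordered) product, the
last vector `u m` to `(∏ i, c i) • u 0`. [folklore] -/
theorem ofFn_prod_mulVec_last {R : Type*} [CommRing R] {ι : Type*} [Fintype ι] [DecidableEq ι] :
    ∀ (m : ℕ) (f : Fin m → Matrix ι ι R) (u : Fin (m + 1) → ι → R) (c : Fin m → R),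
      (∀ i, f i *ᵥ u i.succ = c i • u i.castSucc) →
      (List.ofFn f).prod *ᵥ u (Fin.last m) = (∏ i, c i) • u 0
  | 0, f, u, c, _ => by simp
  | m + 1, f, u, c, h => by
    have ih := ofFn_prod_mulVec_last m (fun i => f i.succ) (fun j => u j.succ) (fun i => c i.succ)
      fun i => by simpa only [Fin.succ_castSucc] using h i.succ
    have hlast : Fin.last (m + 1) = (Fin.last m).succ := rfl
    rw [List.ofFn_succ, List.prod_cons, ← Matrix.mulVec_mulVec, hlast, ih, Matrix.mulVec_smul, h 0,
      smul_smul, Fin.castSucc_zero, Fin.prod_univ_succ, mul_comm (c 0)]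

/-- **Path evaluation of a monomial.**  If `Y` acts diagonally on vectors `u 0, …, u k` with
eigenvalues `0, 1, …, k` and `Z i` moves `u (i+1)` to `u i`, then the monomial
`Y^{σ 0} Z_0 Y^{σ 1} Z_1 ⋯ Z_{k-1} Y^{σ k}` moves `u k` to `(∏ j, j ^ {σ j}) • u 0`. [folklore] -/
theorem capMon_mulVec_last {R : Type*} [CommRing R] {ι : Type*} [Fintype ι] [DecidableEq ι]
    (k : ℕ) {Y : Matrix ι ι R} {Z : Fin k → Matrix ι ι R} {u : Fin (k + 1) → ι → R}
    (hY : ∀ j : Fin (k + 1), Y *ᵥ u j = ((j : ℕ) : R) • u j)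
    (hZ : ∀ i : Fin k, Z i *ᵥ u i.succ = u i.castSucc) (σ : Perm (Fin (k + 1))) :
    capMon k Y Z σ *ᵥ u (Fin.last k) = (∏ j : Fin (k + 1), ((j : ℕ) : R) ^ (σ j : ℕ)) • u 0 := by
  have hchain := ofFn_prod_mulVec_last k (fun i => Z i * Y ^ (σ i.succ : ℕ)) u
    (fun i => (((i.succ : Fin (k + 1)) : ℕ) : R) ^ (σ i.succ : ℕ)) fun i => by
      rw [← Matrix.mulVec_mulVec, pow_mulVec_of_mulVec_eq_smul (hY i.succ), Matrix.mulVec_smul, hZ]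
  have hprod : ∏ j : Fin (k + 1), ((j : ℕ) : R) ^ (σ j : ℕ) =
      (((0 : Fin (k + 1)) : ℕ) : R) ^ (σ 0 : ℕ) *
        ∏ i : Fin k, (((i.succ : Fin (k + 1)) : ℕ) : R) ^ (σ i.succ : ℕ) :=
    Fin.prod_univ_succ _
  rw [capMon, ← Matrix.mulVec_mulVec, hchain, Matrix.mulVec_smul,
    pow_mulVec_of_mulVec_eq_smul (hY 0), smul_smul, hprod, mul_comm]

/-- **Path evaluation of the Cayley–Hamilton–Capelli polynomial**: with `Y`, `Z`, `u` as in
`capMon_mulVec_last`, `P_k(Y; Z)` moves `u k` to `det V • u 0`, `V` the Vandermonde matrix of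
`0, 1, …, k`. [folklore] -/
theorem capPow_mulVec_last {R : Type*} [CommRing R] {ι : Type*} [Fintype ι] [DecidableEq ι]
    (k : ℕ) {Y : Matrix ι ι R} {Z : Fin k → Matrix ι ι R} {u : Fin (k + 1) → ι → R}
    (hY : ∀ j : Fin (k + 1), Y *ᵥ u j = ((j : ℕ) : R) • u j)
    (hZ : ∀ i : Fin k, Z i *ᵥ u i.succ = u i.castSucc) :
    capPow k Y Z *ᵥ u (Fin.last k) =
      (Matrix.vandermonde fun j : Fin (k + 1) => ((j : ℕ) : R)).det • u 0 := by
  rw [← Matrix.det_transpose, Matrix.det_apply', capPow, Matrix.sum_mulVec, Finset.sum_smul]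
  refine Finset.sum_congr rfl fun σ _ => ?_
  rw [Units.smul_def, ← Int.cast_smul_eq_zsmul R, Matrix.smul_mulVec, capMon_mulVec_last k hY hZ σ,
    smul_smul]
  congr 2

/-! ### The stub -/

/-- **No slow masquerade (the frame argument).**  For every `k` there is `C` (namely
`C = (k+2)(k(k+1)/2 + k)`) such that a pair generating `M_n`, `n > k`, in degree `d` and satisfying
every two-letter identity of `M_k` of degree `≤ 2d` has `d ≤ C·n`: fill the frame `e_0, …, e_k` by
`V_{(k+1)n+1}` (`exists_mem_wordSpan_mulVec_single_eq`) with a diagonal `Y` (eigenvalues `0, …, k`)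
and the path `Z_i e_{i+1} = e_i`; the Cayley–Hamilton–Capelli polynomial `P_k(Y; Z)` then moves `e_k`
to `det(Vandermonde) e_0 ≠ 0` (`capPow_mulVec_last`), while the window kills `P_k(Y; Z)` as soon as
`((k+1)n+1)(k(k+1)/2 + k) ≤ 2d` (`Masquerade.capPow_eq_zero_of_window`). [folklore] -/
theorem stub_noSlowMasquerade : ∀ k : ℕ, ∃ C : ℕ, ∀ (n d : ℕ) (A : Fin 2 → Matrix (Fin n) (Fin n) ℂ),
    k < n →
    Submodule.span ℂ {M : Matrix (Fin n) (Fin n) ℂ |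
      ∃ w : List (Fin 2), w.length ≤ d ∧ (w.map A).prod = M} = ⊤ →
    (∀ (T : Finset (List (Fin 2))) (c : List (Fin 2) → ℂ), (∀ w ∈ T, w.length ≤ 2 * d) →
      (∀ B : Fin 2 → Matrix (Fin k) (Fin k) ℂ, (∑ w ∈ T, c w • (w.map B).prod) = 0) →
      (∑ w ∈ T, c w • (w.map A).prod) = 0) →
    d ≤ C * n := by
  intro k
  refine ⟨(k + 2) * (k * (k + 1) / 2 + k), fun n d A hkn hspan hmasq => ?_⟩
  by_contra hd
  push Not at hd
  have hk1 : k + 1 ≤ n := hkn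
  -- `Y ∈ V_{(k+1)n+1}` diagonal on the frame `e_0, …, e_k`, eigenvalues `0, …, k`
  obtain ⟨Y, hYmem, hY⟩ := exists_mem_wordSpan_mulVec_single_eq hk1 hspan
    fun j : Fin (k + 1) => ((j : ℕ) : ℂ) • Pi.single (Fin.castLE hk1 j) (1 : ℂ)
  -- `Z i ∈ V_{(k+1)n+1}` moving `e_{i+1}` to `e_i`
  choose Z hZmem hZ using fun i : Fin k => exists_mem_wordSpan_mulVec_single_eq hk1 hspan
    (Pi.single (i.succ : Fin (k + 1)) (Pi.single (Fin.castLE hk1 i.castSucc) (1 : ℂ)))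
  have hZ' : ∀ i : Fin k, Z i *ᵥ Pi.single (Fin.castLE hk1 i.succ) (1 : ℂ) =
      Pi.single (Fin.castLE hk1 i.castSucc) (1 : ℂ) := fun i => by
    rw [hZ i, Pi.single_eq_same]
  -- the window kills `P_k(Y; Z)`
  have hzero : capPow k Y Z = 0 := by
    refine capPow_eq_zero_of_window hmasq (L := (k + 1) * n + 1) (e := fun _ => (k + 1) * n + 1)
      ?_ hYmem hZmem
    simp only [Finset.sum_const, Finset.card_univ, Fintype.card_fin, smul_eq_mul]
    set q : ℕ := k * (k + 1) / 2 with hq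
    have hn : 0 < n := by omega
    nlinarith [Nat.le_mul_of_pos_right q hn, Nat.le_mul_of_pos_right k hn]
  -- but it moves `e_k` to a non-zero multiple of `e_0`
  have hne : capPow k Y Z *ᵥ Pi.single (Fin.castLE hk1 (Fin.last k)) (1 : ℂ) ≠ 0 := by
    rw [capPow_mulVec_last k (u := fun j => Pi.single (Fin.castLE hk1 j) (1 : ℂ)) hY hZ']
    refine smul_ne_zero ?_ ?_
    · exact Matrix.det_vandermonde_ne_zero_iff.2 fun i j h => Fin.ext (Nat.cast_injective h)
    · exact Pi.single_ne_zero_iff.2 one_ne_zero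
  exact hne (by rw [hzero, Matrix.zero_mulVec])

end Summit.MatrixMultiplication.MatrixMultiplication.Theorems.TightWindows
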